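import Summits.CriticalPhenomena.PercolationContinuityZ3.Theorems.SoloBlindSquareFin
import Mathlib.Analysis.PSeries

/-!
# Fins with gaps `≫ log`, continuity at their own critical point, and infinite sparse fins

Seat `solo-CriticalPhenomena-blind`.  Corollaries of `SoloBlindSquareFin` / `SoloBlindSparseFins`:

* `criticalProb_induce_sparseFin_eq`, `theta_induce_sparseFin_own_criticalProb_eq_zero_of_gaps` —
  modulo the named fact `GrimmettMarstrand1990_halfSpace` (`p_c(ℍ) = p_c(ℤ³)`) every `S_Z` has
  `p_c(S_Z) = p_c(ℤ³)`, so the gap fins are continuous at their OWN critical point;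
* `theta_induce_sparseFin_criticalProbI_eq_zero_of_tendsto_div_log` — the natural form of the
  hypothesis: `(f (k+1) - f k) / log k → ∞` suffices (eventually `exp(-c·gap_k) ≤ k⁻²`);
* `exists_infinite_sparseFin_theta_criticalProbI_eq_zero` (+ `_own_` version) — infinite `Z` with
  `θ_{S_Z}(p_c(ℤ³)) = 0` exist by BGN alone (`BoundaryDecay.exists_infinite_sparse_connectors`),
  with no planar input.
-/

noncomputable section

namespace Summit.CriticalPhenomena.PercolationContinuityZ3.Theorems

open MeasureTheory Literature.Probability.Percolation Literature.Probability.LatticeModels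
open Literature.Probability.Percolation.RegionGluing Literature.Probability.Percolation.BoundaryDecay

section OwnCriticalPoint

/-- Modulo Grimmett–Marstrand (`p_c(ℍ) = p_c(ℤ³)`, a named fact), every sparse-fin region `S_Z`
(it contains `ℍ`) has critical point `p_c(ℤ³)` at the root `0`. -/
theorem criticalProb_induce_sparseFin_eq (hGM : GrimmettMarstrand1990_halfSpace) (Z : Set ℤ)
    (h0 : (0 : Site 3) ∈ {x : Site 3 | 0 ≤ x 0} ∪
      {x : Site 3 | (x 1 = 0 ∧ x 0 ≤ -2) ∨ (x 1 = 0 ∧ x 0 = -1 ∧ x 2 ∈ Z)}) :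
    criticalProb ((zdGraph 3).induce ({x : Site 3 | 0 ≤ x 0} ∪
      {x : Site 3 | (x 1 = 0 ∧ x 0 ≤ -2) ∨ (x 1 = 0 ∧ x 0 = -1 ∧ x 2 ∈ Z)})) ⟨0, h0⟩ =
      criticalProb (zdGraph 3) 0 := by
  have hsub : halfSpace 3 ⊆ {x : Site 3 | 0 ≤ x 0} ∪
      {x : Site 3 | (x 1 = 0 ∧ x 0 ≤ -2) ∨ (x 1 = 0 ∧ x 0 = -1 ∧ x 2 ∈ Z)} := fun x hx => Or.inl hx
  refine le_antisymm ?_ (criticalProb_le_induce theta_induce_le_holds (zdGraph 3) _ 0 h0)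
  calc criticalProb ((zdGraph 3).induce ({x : Site 3 | 0 ≤ x 0} ∪
        {x : Site 3 | (x 1 = 0 ∧ x 0 ≤ -2) ∨ (x 1 = 0 ∧ x 0 = -1 ∧ x 2 ∈ Z)})) ⟨0, h0⟩
      ≤ criticalProb ((zdGraph 3).induce (halfSpace 3)) ⟨0, zero_mem_halfSpace 3⟩ :=
        criticalProb_induce_anti theta_induce_mono_holds (zdGraph 3) hsub 0 (zero_mem_halfSpace 3)
    _ = criticalProb (zdGraph 3) 0 := hGM 3 (by norm_num)

/-- **Fins with super-logarithmic gaps are continuous at their own critical point** (modulo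
Grimmett–Marstrand): for every strictly increasing `f : ℕ → ℤ` with exp-summable gaps at every
rate, `θ_{S}(p_c(S)) = 0` for `S = ℍ ∪ {x₁ = 0, x₀ ≤ -2} ∪ {(-1, 0, f k)}` — an explicit family of
connected regions strictly between `ℍ` and `ℤ³`, in no half-space. -/
theorem theta_induce_sparseFin_own_criticalProb_eq_zero_of_gaps
    (hGM : GrimmettMarstrand1990_halfSpace) {f : ℕ → ℤ} (hf : StrictMono f)
    (hgap : ∀ c : ℝ, 0 < c →
      ∑' k : ℕ, ENNReal.ofReal (Real.exp (-c * ((f (k + 1) - f k : ℤ) : ℝ))) ≠ ⊤) :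
    ∃ h0 : (0 : Site 3) ∈ {x : Site 3 | 0 ≤ x 0} ∪
        {x : Site 3 | (x 1 = 0 ∧ x 0 ≤ -2) ∨ (x 1 = 0 ∧ x 0 = -1 ∧ x 2 ∈ Set.range f)},
      theta ((zdGraph 3).induce ({x : Site 3 | 0 ≤ x 0} ∪
          {x : Site 3 | (x 1 = 0 ∧ x 0 ≤ -2) ∨ (x 1 = 0 ∧ x 0 = -1 ∧ x 2 ∈ Set.range f)}))
          ⟨0, h0⟩
        ⟨criticalProb ((zdGraph 3).induce ({x : Site 3 | 0 ≤ x 0} ∪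
            {x : Site 3 | (x 1 = 0 ∧ x 0 ≤ -2) ∨ (x 1 = 0 ∧ x 0 = -1 ∧ x 2 ∈ Set.range f)}))
            ⟨0, h0⟩, criticalProb_mem_Icc _ _⟩ = 0 := by
  have h0 : (0 : Site 3) ∈ {x : Site 3 | 0 ≤ x 0} ∪
      {x : Site 3 | (x 1 = 0 ∧ x 0 ≤ -2) ∨ (x 1 = 0 ∧ x 0 = -1 ∧ x 2 ∈ Set.range f)} :=
    Or.inl (show (0 : ℤ) ≤ (0 : Site 3) 0 from le_rfl)
  refine ⟨h0, ?_⟩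
  have hI : (⟨criticalProb ((zdGraph 3).induce ({x : Site 3 | 0 ≤ x 0} ∪
      {x : Site 3 | (x 1 = 0 ∧ x 0 ≤ -2) ∨ (x 1 = 0 ∧ x 0 = -1 ∧ x 2 ∈ Set.range f)})) ⟨0, h0⟩,
        criticalProb_mem_Icc _ _⟩ : unitInterval) = criticalProbI 3 :=
    Subtype.ext (criticalProb_induce_sparseFin_eq hGM (Set.range f) h0)
  rw [hI]
  exact theta_induce_sparseFin_criticalProbI_eq_zero_of_gaps hf hgap 0 h0

end OwnCriticalPoint

section LogGaps

/-- Gaps growing faster than `log` are exp-summable at every rate: if `(f (k+1) - f k) / log k → ∞`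
then `Σ_k exp(-c (f (k+1) - f k)) < ∞` for every `c > 0` (eventually `exp(-c gap_k) ≤ k⁻²`). -/
theorem tsum_exp_gap_ne_top_of_tendsto_div_log {f : ℕ → ℤ}
    (hlog : Filter.Tendsto (fun k : ℕ => ((f (k + 1) - f k : ℤ) : ℝ) / Real.log k)
      Filter.atTop Filter.atTop)
    {c : ℝ} (hc : 0 < c) :
    ∑' k : ℕ, ENNReal.ofReal (Real.exp (-c * ((f (k + 1) - f k : ℤ) : ℝ))) ≠ ⊤ := by
  have hev : ∀ᶠ k : ℕ in Filter.atTop,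
      Real.exp (-c * ((f (k + 1) - f k : ℤ) : ℝ)) ≤ 1 / (k : ℝ) ^ 2 := by
    have h1 := hlog.eventually_ge_atTop (2 / c)
    have h2 : ∀ᶠ k : ℕ in Filter.atTop, 2 ≤ k := Filter.eventually_ge_atTop 2
    filter_upwards [h1, h2] with k hk hk2
    have hkpos : (0 : ℝ) < k := by exact_mod_cast (show 0 < k by omega)
    have hlogpos : 0 < Real.log k := Real.log_pos (by exact_mod_cast (show 1 < k by omega))
    have hgap : 2 / c * Real.log k ≤ ((f (k + 1) - f k : ℤ) : ℝ) := by
      rwa [le_div_iff₀ hlogpos] at hk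
    have hmul : 2 * Real.log k ≤ c * ((f (k + 1) - f k : ℤ) : ℝ) := by
      have := mul_le_mul_of_nonneg_left hgap hc.le
      rwa [show c * (2 / c * Real.log k) = 2 * Real.log k by field_simp] at this
    calc Real.exp (-c * ((f (k + 1) - f k : ℤ) : ℝ))
        ≤ Real.exp (-(2 * Real.log k)) := Real.exp_le_exp.2 (by linarith)
      _ = 1 / (k : ℝ) ^ 2 := by
          rw [Real.exp_neg, show (2 : ℝ) * Real.log k = Real.log k + Real.log k by ring,
            Real.exp_add, Real.exp_log hkpos, one_div, pow_two]
  have hsum : Summable (fun k : ℕ => Real.exp (-c * ((f (k + 1) - f k : ℤ) : ℝ))) := by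
    refine Summable.of_norm_bounded_eventually_nat
      (Real.summable_one_div_nat_pow.2 (by norm_num : 1 < 2)) ?_
    filter_upwards [hev] with k hk
    rw [Real.norm_of_nonneg (Real.exp_pos _).le]
    exact hk
  rw [← ENNReal.ofReal_tsum_of_nonneg (fun k => (Real.exp_pos _).le) hsum]
  exact ENNReal.ofReal_ne_top

/-- **Fins with gaps `≫ log`: the headline in its natural form.** For strictly increasing heights
`f : ℕ → ℤ` with `(f (k+1) - f k) / log k → ∞`, the region `ℍ ∪ {x₁ = 0, x₀ ≤ -2} ∪ {(-1, 0, f k)}`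
has `θ(p_c(ℤ³)) = 0` at every root — unconditionally. (Squares, cubes, `2^k`, `k ⌈log k⌉²`, …;
NOT covered: bounded gaps, primes.) -/
theorem theta_induce_sparseFin_criticalProbI_eq_zero_of_tendsto_div_log {f : ℕ → ℤ}
    (hf : StrictMono f)
    (hlog : Filter.Tendsto (fun k : ℕ => ((f (k + 1) - f k : ℤ) : ℝ) / Real.log k)
      Filter.atTop Filter.atTop)
    (x : Site 3)
    (hx : x ∈ {x : Site 3 | 0 ≤ x 0} ∪
      {x : Site 3 | (x 1 = 0 ∧ x 0 ≤ -2) ∨ (x 1 = 0 ∧ x 0 = -1 ∧ x 2 ∈ Set.range f)}) :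
    theta ((zdGraph 3).induce ({x : Site 3 | 0 ≤ x 0} ∪
      {x : Site 3 | (x 1 = 0 ∧ x 0 ≤ -2) ∨ (x 1 = 0 ∧ x 0 = -1 ∧ x 2 ∈ Set.range f)})) ⟨x, hx⟩
      (criticalProbI 3) = 0 :=
  theta_induce_sparseFin_criticalProbI_eq_zero_of_gaps hf
    (fun _ hc => tsum_exp_gap_ne_top_of_tendsto_div_log hlog hc) x hx

/-- Modulo Grimmett–Marstrand, fins with `gap / log → ∞` are continuous at their own critical point. -/
theorem theta_induce_sparseFin_own_criticalProb_eq_zero_of_tendsto_div_log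
    (hGM : GrimmettMarstrand1990_halfSpace) {f : ℕ → ℤ} (hf : StrictMono f)
    (hlog : Filter.Tendsto (fun k : ℕ => ((f (k + 1) - f k : ℤ) : ℝ) / Real.log k)
      Filter.atTop Filter.atTop) :
    ∃ h0 : (0 : Site 3) ∈ {x : Site 3 | 0 ≤ x 0} ∪
        {x : Site 3 | (x 1 = 0 ∧ x 0 ≤ -2) ∨ (x 1 = 0 ∧ x 0 = -1 ∧ x 2 ∈ Set.range f)},
      theta ((zdGraph 3).induce ({x : Site 3 | 0 ≤ x 0} ∪
          {x : Site 3 | (x 1 = 0 ∧ x 0 ≤ -2) ∨ (x 1 = 0 ∧ x 0 = -1 ∧ x 2 ∈ Set.range f)}))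
          ⟨0, h0⟩
        ⟨criticalProb ((zdGraph 3).induce ({x : Site 3 | 0 ≤ x 0} ∪
            {x : Site 3 | (x 1 = 0 ∧ x 0 ≤ -2) ∨ (x 1 = 0 ∧ x 0 = -1 ∧ x 2 ∈ Set.range f)}))
            ⟨0, h0⟩, criticalProb_mem_Icc _ _⟩ = 0 :=
  theta_induce_sparseFin_own_criticalProb_eq_zero_of_gaps hGM hf
    (fun _ hc => tsum_exp_gap_ne_top_of_tendsto_div_log hlog hc)

end LogGaps


/-- **Corollary (unconditional).** There is an infinite set of heights `Z` such that critical bond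
percolation on `ℤ³` restricted to `S_Z = ℍ ∪ {x₁ = 0, x₀ ≤ -2} ∪ {(-1,0,z) : z ∈ Z}` — a region
containing the half-space and an infinite planar sheet attached to it at infinitely many points,
contained in no half-space — has `θ(p_c(ℤ³)) = 0` at every root. -/
theorem exists_infinite_sparseFin_theta_criticalProbI_eq_zero :
    ∃ Z : Set ℤ, Z.Infinite ∧ ∀ (x : Site 3)
      (hx : x ∈ {x : Site 3 | 0 ≤ x 0} ∪
        {x : Site 3 | (x 1 = 0 ∧ x 0 ≤ -2) ∨ (x 1 = 0 ∧ x 0 = -1 ∧ x 2 ∈ Z)}),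
      theta ((zdGraph 3).induce ({x : Site 3 | 0 ≤ x 0} ∪
        {x : Site 3 | (x 1 = 0 ∧ x 0 ≤ -2) ∨ (x 1 = 0 ∧ x 0 = -1 ∧ x 2 ∈ Z)})) ⟨x, hx⟩
        (criticalProbI 3) = 0 := by
  obtain ⟨Z, hZ, hsum⟩ := exists_infinite_sparse_connectors
  exact ⟨Z, hZ, fun x hx => theta_induce_sparseFin_criticalProbI_eq_zero Z hsum x hx⟩


/-- **Continuity at its own critical point, modulo Grimmett–Marstrand.** For the sparse-fin
regions `S_Z` (which contain `ℍ`), `p_c(S_Z) = p_c(ℤ³)` by `p_c(ℍ) = p_c(ℤ³)` (the named fact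
`GrimmettMarstrand1990_halfSpace`) and induce-monotonicity; hence, for the infinite `Z` above,
`θ_{S_Z}(p_c(S_Z)) = 0`: a family of connected regions strictly between the half-space and `ℤ³`,
contained in no half-space, whose percolation probability is continuous at their OWN critical
point. -/
theorem exists_infinite_sparseFin_theta_own_criticalProb_eq_zero
    (hGM : GrimmettMarstrand1990_halfSpace) :
    ∃ Z : Set ℤ, Z.Infinite ∧
      ∃ h0 : (0 : Site 3) ∈ {x : Site 3 | 0 ≤ x 0} ∪
          {x : Site 3 | (x 1 = 0 ∧ x 0 ≤ -2) ∨ (x 1 = 0 ∧ x 0 = -1 ∧ x 2 ∈ Z)},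
        theta ((zdGraph 3).induce ({x : Site 3 | 0 ≤ x 0} ∪
            {x : Site 3 | (x 1 = 0 ∧ x 0 ≤ -2) ∨ (x 1 = 0 ∧ x 0 = -1 ∧ x 2 ∈ Z)})) ⟨0, h0⟩
          ⟨criticalProb ((zdGraph 3).induce ({x : Site 3 | 0 ≤ x 0} ∪
              {x : Site 3 | (x 1 = 0 ∧ x 0 ≤ -2) ∨ (x 1 = 0 ∧ x 0 = -1 ∧ x 2 ∈ Z)})) ⟨0, h0⟩,
            criticalProb_mem_Icc _ _⟩ = 0 := by
  obtain ⟨Z, hZ, hθ⟩ := exists_infinite_sparseFin_theta_criticalProbI_eq_zero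
  have h0 : (0 : Site 3) ∈ {x : Site 3 | 0 ≤ x 0} ∪
      {x : Site 3 | (x 1 = 0 ∧ x 0 ≤ -2) ∨ (x 1 = 0 ∧ x 0 = -1 ∧ x 2 ∈ Z)} :=
    Or.inl (show (0 : ℤ) ≤ (0 : Site 3) 0 from le_rfl)
  refine ⟨Z, hZ, h0, ?_⟩
  have hsub : halfSpace 3 ⊆ {x : Site 3 | 0 ≤ x 0} ∪
      {x : Site 3 | (x 1 = 0 ∧ x 0 ≤ -2) ∨ (x 1 = 0 ∧ x 0 = -1 ∧ x 2 ∈ Z)} := fun x hx => Or.inl hx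
  have hpc : criticalProb ((zdGraph 3).induce ({x : Site 3 | 0 ≤ x 0} ∪
      {x : Site 3 | (x 1 = 0 ∧ x 0 ≤ -2) ∨ (x 1 = 0 ∧ x 0 = -1 ∧ x 2 ∈ Z)})) ⟨0, h0⟩ =
      criticalProb (zdGraph 3) 0 := by
    refine le_antisymm ?_ (criticalProb_le_induce theta_induce_le_holds (zdGraph 3) _ 0 h0)
    calc criticalProb ((zdGraph 3).induce ({x : Site 3 | 0 ≤ x 0} ∪
          {x : Site 3 | (x 1 = 0 ∧ x 0 ≤ -2) ∨ (x 1 = 0 ∧ x 0 = -1 ∧ x 2 ∈ Z)})) ⟨0, h0⟩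
        ≤ criticalProb ((zdGraph 3).induce (halfSpace 3)) ⟨0, zero_mem_halfSpace 3⟩ :=
          criticalProb_induce_anti theta_induce_mono_holds (zdGraph 3) hsub 0 (zero_mem_halfSpace 3)
      _ = criticalProb (zdGraph 3) 0 := hGM 3 (by norm_num)
  have hI : (⟨criticalProb ((zdGraph 3).induce ({x : Site 3 | 0 ≤ x 0} ∪
      {x : Site 3 | (x 1 = 0 ∧ x 0 ≤ -2) ∨ (x 1 = 0 ∧ x 0 = -1 ∧ x 2 ∈ Z)})) ⟨0, h0⟩,
        criticalProb_mem_Icc _ _⟩ : unitInterval) = criticalProbI 3 := Subtype.ext hpc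
  rw [hI]
  exact hθ 0 h0


end Summit.CriticalPhenomena.PercolationContinuityZ3.Theorems
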